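import Literature.Geometry.DiscreteGeometry.EnergyLinearProgrammingBound

/-!
# The Thomson problem for six points: the octahedron's Coulomb energy is a lower bound (sharp)

Framing: lottery ticket; floor = certified bounds/negative ranges. Venture `PackingBounds` (cell
`pub-packcert`, seat `pub-packcert-energy`), energy-minimisation family, **sharp + control** over
`ℚ(√2)`.

**Theorem (Cohn–Kumar 2007, Thm. 1.2, cross-polytope; LP-sharp Thomson case `N = 6`).** Every
configuration of `6` unit vectors `C ⊂ ℝ³` has `Σ_{x ≠ y ∈ C} |x - y|⁻¹ ≥ 3 + 12 √2 = 19.9705…`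
(ordered pairs), the Coulomb energy of the regular octahedron (four neighbours at distance `√2`,
one antipode at distance `2` per vertex). Certificate: the Hermite interpolant
`h(t) = √2/2 + (√2/4) t + (1/2 - √2/4) t²` of `(2-2t)^(-1/2)` at `-1` (simple) and `0` (double),
Legendre coefficients `(1/6 + 5√2/12, √2/4, 1/3 - √2/6) ≥ 0`, identity
`1 - (2-2t) h² = t² (1+t) q(t)` checked by `linear_combination` modulo `r² = 2`, `q ≥ 0` on
`[-1,1]` by a Handelman form.

## References
* H. Cohn, A. Kumar, J. Amer. Math. Soc. 20 (2007) 99–148, Thm. 1.2, Prop. 4.1. [`CohnKumar2006`]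
-/

namespace Summit.Ventures.PackingBounds.Energy

open Finset Literature.Analysis.SpecialFunctions Literature.Geometry.DiscreteGeometry

open scoped Classical in
/-- **Thomson problem, `N = 6` (lower bound, sharp)**: every `6` unit vectors of `ℝ³` have
`Σ_{x ≠ y} |x - y|⁻¹ ≥ 3 + 12 √2`, the Coulomb energy of the regular octahedron.
[cite: CohnKumar2006, Theorem 1.2 and Proposition 4.1] -/
theorem coulomb_energy_card6_ge_octahedron (C : Finset (EuclideanSpace ℝ (Fin 3)))
    (h1 : ∀ x ∈ C, ‖x‖ = 1) (hN : C.card = 6) :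
    3 + 12 * Real.sqrt 2 ≤ ∑ x ∈ C, ∑ y ∈ C.erase x, ‖x - y‖⁻¹ := by
  set r : ℝ := Real.sqrt 2 with hrdef
  have hr2 : r ^ 2 = 2 := Real.sq_sqrt (by norm_num)
  have hr0 : 0 < r := Real.sqrt_pos.mpr (by norm_num)
  have hrl : (14142 : ℝ) / 10000 < r := by nlinarith [hr2, hr0]
  have hru : r < (14143 : ℝ) / 10000 := by nlinarith [hr2, hr0]
  have hα : ∀ k : ℕ, (0 : ℝ) ≤ (fun k => match k with | 0 => 1 / 6 + 5 / 12 * r | 1 => 1 / 4 * r | 2 => 1 / 3 - 1 / 6 * r | _ => 0) k := by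
    intro k
    dsimp only
    split <;> linarith [hrl, hru]
  have hH : ∀ t : ℝ, -1 ≤ t → t < 1 →
      ∑ k ∈ range (2 + 1), (fun k => match k with | 0 => 1 / 6 + 5 / 12 * r | 1 => 1 / 4 * r | 2 => 1 / 3 - 1 / 6 * r | _ => 0) k * gegenbauerSum (1 / 2 : ℝ) k t ≤
        (fun u : ℝ => (Real.sqrt (2 - 2 * u))⁻¹) t := by
    intro t ht1 ht2
    have hsum : ∑ k ∈ range (2 + 1), (fun k => match k with | 0 => 1 / 6 + 5 / 12 * r | 1 => 1 / 4 * r | 2 => 1 / 3 - 1 / 6 * r | _ => 0) k * gegenbauerSum (1 / 2 : ℝ) k t =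
        (1 / 2 * r) + (1 / 4 * r) * t + (1 / 2 - 1 / 4 * r) * t ^ 2 := by
      simp [Finset.sum_range_succ, gegenbauerSum, gegenbauerCoeff, Finset.prod_range_succ,
        Nat.factorial]
      ring
    rw [hsum]
    have hpos : (0 : ℝ) < 2 - 2 * t := by linarith
    have hA : (0 : ℝ) ≤ 1 + t := by linarith
    have hB : (0 : ℝ) ≤ 1 - t := by linarith
    have hid : ((1 / 2 * r) + (1 / 4 * r) * t + (1 / 2 - 1 / 4 * r) * t ^ 2) ^ 2 * (2 - 2 * t) = 1 - (t ^ 2 * (1 + t)) * ((7 / 4 - r) + (-2 + 3 / 2 * r) * t + (3 / 4 - 1 / 2 * r) * t ^ 2) := by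
      linear_combination (1 / 2 - 7 / 8 * t ^ 2 + 1 / 8 * t ^ 3 + 3 / 8 * t ^ 4 - 1 / 8 * t ^ 5) * hr2
    have hW : (0 : ℝ) ≤ t ^ 2 * (1 + t) := mul_nonneg (sq_nonneg _) hA
    have hb0 : (0 : ℝ) ≤ 9 / 8 - 3 / 4 * r := by linarith [hrl, hru]
    have hb1 : (0 : ℝ) ≤ 1 / 2 - 1 / 4 * r := by linarith [hrl, hru]
    have hb2 : (0 : ℝ) ≤ 1 / 8 := by linarith [hrl, hru]
    have hqid : (7 / 4 - r) + (-2 + 3 / 2 * r) * t + (3 / 4 - 1 / 2 * r) * t ^ 2 = (9 / 8 - 3 / 4 * r) * (1 - t) ^ 2 + (1 / 2 - 1 / 4 * r) * (1 + t) * (1 - t) + (1 / 8) * (1 + t) ^ 2 := by ring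
    have hq : (0 : ℝ) ≤ (7 / 4 - r) + (-2 + 3 / 2 * r) * t + (3 / 4 - 1 / 2 * r) * t ^ 2 := by
      rw [hqid]
      exact add_nonneg (add_nonneg (mul_nonneg hb0 (pow_nonneg hB 2))
        (mul_nonneg (mul_nonneg hb1 hA) hB)) (mul_nonneg hb2 (pow_nonneg hA 2))
    have hG : ((1 / 2 * r) + (1 / 4 * r) * t + (1 / 2 - 1 / 4 * r) * t ^ 2) ^ 2 * (2 - 2 * t) ≤ 1 := by linarith [mul_nonneg hW hq, hid]
    show _ ≤ (Real.sqrt (2 - 2 * t))⁻¹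
    have hsr : (0 : ℝ) < Real.sqrt (2 - 2 * t) := Real.sqrt_pos.mpr hpos
    have hss : Real.sqrt (2 - 2 * t) ^ 2 = 2 - 2 * t := Real.sq_sqrt hpos.le
    rw [inv_eq_one_div, le_div_iff₀ hsr]
    have h2 : ((1 / 2 * r) + (1 / 4 * r) * t + (1 / 2 - 1 / 4 * r) * t ^ 2) * Real.sqrt (2 - 2 * t) * (((1 / 2 * r) + (1 / 4 * r) * t + (1 / 2 - 1 / 4 * r) * t ^ 2) * Real.sqrt (2 - 2 * t)) ≤ 1 := by
      have hrr : ((1 / 2 * r) + (1 / 4 * r) * t + (1 / 2 - 1 / 4 * r) * t ^ 2) * Real.sqrt (2 - 2 * t) * (((1 / 2 * r) + (1 / 4 * r) * t + (1 / 2 - 1 / 4 * r) * t ^ 2) * Real.sqrt (2 - 2 * t)) =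
          ((1 / 2 * r) + (1 / 4 * r) * t + (1 / 2 - 1 / 4 * r) * t ^ 2) ^ 2 * Real.sqrt (2 - 2 * t) ^ 2 := by ring
      rw [hrr, hss]
      exact hG
    exact le_trans (le_abs_self _) (abs_le_one_iff_mul_self_le_one.mpr h2)
  have key := EnergyLP.energy_ge_inner (n := 3) (μ := 1 / 2) (by norm_num) (by norm_num) 2
    (fun k => match k with | 0 => 1 / 6 + 5 / 12 * r | 1 => 1 / 4 * r | 2 => 1 / 3 - 1 / 6 * r | _ => 0) hα (fun u : ℝ => (Real.sqrt (2 - 2 * u))⁻¹) hH C h1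
  rw [hN] at key
  have hconv : ∑ x ∈ C, ∑ y ∈ C.erase x,
      (fun u : ℝ => (Real.sqrt (2 - 2 * u))⁻¹) (inner ℝ x y) =
      ∑ x ∈ C, ∑ y ∈ C.erase x, ‖x - y‖⁻¹ := by
    refine Finset.sum_congr rfl fun x hx => Finset.sum_congr rfl fun y hy => ?_
    have hyC : y ∈ C := Finset.mem_of_mem_erase hy
    have hsq : ‖x - y‖ ^ 2 = 2 - 2 * inner ℝ x y := by
      rw [@norm_sub_sq_real, h1 x hx, h1 y hyC]; ring
    show (Real.sqrt (2 - 2 * inner ℝ x y))⁻¹ = ‖x - y‖⁻¹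
    rw [← hsq, Real.sqrt_sq (norm_nonneg _)]
  rw [hconv] at key
  refine le_trans (le_of_eq ?_) key
  simp [Finset.sum_range_succ, gegenbauerSum, gegenbauerCoeff, Finset.prod_range_succ,
    Nat.factorial]
  ring

end Summit.Ventures.PackingBounds.Energy
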